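import Summits.MatrixMultiplication.MatrixMultiplication.Theorems.AbelianSTPPCensusTAStatEDefs

/-!
# T_A static certificate, range `6380 … 6779` (t*-indexed linear checker with the k-member tree at `τ = 2371/1000`): kernel evaluation, the domination checks (table and extra U11-G entries), volumes `4801 … 5400`, and completeness chunks of the bucket lists

Cell mm-stpp (rung F-M1), tier T_A = «beat `2.371`, the record exponent (ADVXXZ'25 / DEK+26 rounded)»; checker in `AbelianSTPPCensusTAStatEDefs.lean`, table and bucket lists in `AbelianSTPPCensusTAStatEData.lean`
(pattern: theory g12's `AbelianSTPPCensusTAStatDDom*/DCk*.lean`).  `decide` with kernel reduction (standard axioms; no `native_decide`), `Elab.async false`;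
consumed by `TAStatE.checkV_sound` / `TAStatE.domV_sound` / `TAStatE.m2V_sound` in the leaf `AbelianSTPPCensusLeafTA6779Closed.lean`.
WHAT THIS IS NOT: arithmetic on shape lists only; no statement about STPP families or `ω`.
-/

set_option linter.dupNamespace false
set_option autoImplicit false
set_option Elab.async false

namespace Summit.MatrixMultiplication.MatrixMultiplication.Theorems.TAStatE

set_option maxHeartbeats 0 in
/-- Domination chunk: every sorted candidate shape of the volumes `4801 … 5100` is dominated by the table (2366 shapes). [original] -/
theorem dom4801 : TAStatE.domV 300 4801 = true := by decide +kernel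

set_option maxHeartbeats 0 in
/-- Domination chunk: every sorted candidate shape of the volumes `5101 … 5400` is dominated by the table (2360 shapes). [original] -/
theorem dom5101 : TAStatE.domV 300 5101 = true := by decide +kernel

set_option maxHeartbeats 0 in
/-- Extra-domination chunk: every sorted candidate shape of the volumes `4801 … 5100` is dominated at the extra U11-G entries of every level covering it. [original] -/
theorem xdom4801 : TAStatE.domXTV 300 4801 = true := by decide +kernel

set_option maxHeartbeats 0 in
/-- Extra-domination chunk: every sorted candidate shape of the volumes `5101 … 5400` is dominated at the extra U11-G entries of every level covering it. [original] -/
theorem xdom5101 : TAStatE.domXTV 300 5101 = true := by decide +kernel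

end Summit.MatrixMultiplication.MatrixMultiplication.Theorems.TAStatE
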